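import Literature.MathematicalPhysics.QuantumFieldTheory.Balaban1983to89.B13ResidualLeafProbe
import Literature.MathematicalPhysics.QuantumFieldTheory.Balaban1983to89.B11LeafUnpinnedRecord

/-!
# `Balaban1983to89.B13ResidualSlotProbe` — LOCATED NEGATIVE for node N10 · [Balaban1988RG2Cluster], second probe: at NODE 00's record predicates
# ₅C ∕ ₇C ∕ ₈C the IN-EDGES of N10 do NOT rescue the displayed slot (B13₅) — there is a record at which the leaves `b9`, `b10`, `b11`, `b12` HOLD and
# `b13` FAILS at every run, so the node `Dag.B13_main` («b9 → b10 → b11 → b12 → b13») itself is REFUTABLE there, the slot hypothesis of the seat's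
# closers `B13NodeKnitRecord5C.b13_main_forall_isRecordOfRecord₅C` ∕ `…N10AtRecord.s_N10_rec₅C∕₇C∕₈C` is UNSATISFIABLE, and N10 is UNDETERMINED over
# these predicates (its `∃`-dual is junk-provable)

statement-level bookkeeping over published theorems with citation tags; kernel-checked compositions of tree theorems; nothing here is a claim about
the Yang–Mills mass gap.

Track A, DAG node N10 (KNIT-BY-NAME seat `pub-ymgap-dag-p2` = n10-a, generation 6, 2026-08-26).  This file answers the discharge referee's located
question on the seat's (W2) closer (dag-ref-B READ #249 on `BalabanUVNodesN10AtRecord`, D2: «whether the four in-edge antecedents (also residual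
carriers) rescue the displayed form is not settled by `B13ResidualLeafProbe`»): THEY DO NOT.  Pattern and machinery: n07-a's `B11LeafUnpinnedRecord`
(§1 there: the DATUM is blind to the residual carrier families `X, Y, Z` — `isRecordOfRecord₅C_updXYZ` ∕ `isRecordOfRecord₈C_updXYZ`), n08-a's
`B10LeafUnpinnedRecord5C`, g5's `B13ResidualLeafProbe` (`exists_stepData_not_lemma1`), n06's `B9LeafKnitNonVacuity.exists_b9LeafX_of_vanishing_operators`,
`B11LeafUnpinnedRecord.exists_b11Leaf`, and the seat's `B13NodeKnitRecord5C.b13_main_iff_res₅C` (the node `Iff.rfl`-located at the residual carriers).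

THE WITNESS (given ONE ₅C ∕ ₈C record `(D, w)` with parameters `θ`; same datum `D`, same `γ`, `L`; only the world's upstream binding is swapped):
`Y ↦` n06's [B9] bundle with vanishing operators (its extended leaf `B9LeafX` is a theorem), `Z ↦` the empty-index [B11] bundle (`B11Leaf` vacuous),
`X P ↦ θ.res.X P` with (i) the [B10] run family EMPTIED (`I10 := PEmpty`: [Balaban1985UV3] Thm 1 compact ∧ Thm 2 vacuous), (ii) the [I]-Lemma-4
constants ZEROED (`c12 := 0`: the printed restrictions `0 < α₀ …` fail, so `B12Sec2to5.Lemma4Printed` holds vacuously), (iii) the residual B13 step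
replaced by g5's junk step at the run's constants (`B13.Lemma1Printed` fails).  Hence at every run: `b9 ∧ b10 ∧ b11 ∧ b12 ∧ ¬ b13`, so `¬ Dag.B13_main`,
while the in-edge NODES `Dag.B9_main`, `Dag.B10_main`, `Dag.B11_main`, `Dag.B12_main` all HOLD (the last because its consequent reads `b12 ∧ (b12 → b13 → …)`
and `b13` is false).  DEGENERATE on purpose: a probe of the TYPING over free residual fields, not a statement about Bałaban's objects.

WHAT THIS FILE PROVES (0 `sorry`, 0 `def`, standard axioms).
§1 `exists_stepData_b13Triple` — the `∃`-dual witness: a step datum with NO localization domains at which Lemmas 1–3 AS TYPED hold for every `c`.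
§2 `not_slot₅C` — THE DISPLAYED SLOT (B13₅) «∀ admissible θ, ∀ P, in-edges at the residual carriers ⇒ the B13 triple of the residual group» is FALSE
   as soon as one admissible Stage-5 parameter exists; `not_slot₅C'` — unconditionally (parameters of record exist: `Node00.N24_exists_isRecordOfRecord₅C`).
§3 ₅C: `exists_record₅C_inEdges_not_b13` (the witness record over the same datum), `exists_record₅C_sisters_not_b13_main` (there N06∕N08∕N07∕N09 hold
   and N10 fails at every run), `exists_record₅C_b13_main` (the `∃`-dual: a record at which `b13`, hence N10, holds at every run — vacuously),
   `not_forall_record₅C_b13_main`, and the absolute census `b13_main_undetermined_over_record₅C`.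
§4 ₈C ∕ ₇C: the same (`exists_record₈C_inEdges_not_b13`, `exists_record₈C_sisters_not_b13_main`, `exists_record₈C_b13_main`, `not_forall_record₈C_b13_main`,
   `b13_main_undetermined_over_record₈C`; `not_forall_record₇C_b13_main` through `Node00.isRecordOfRecord₇C_of_isRecordOfRecord₈C`).
CONSEQUENCE (for the plan's (W2)∕(A5) items, the chair's R447 package «K2 ∀-form over a record predicate», and NODE 00): over ₅C ∕ ₇C ∕ ₈C the stub
`YMDAG.UVSplit.S_N10 Rec := AtRecord Rec Dag.B13_main` is FALSE (Summits-side face: `BalabanUVNodesN10RecordCensus`), not merely unproved; every closer of the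
lineage keeps content only through a PIN of the residual B13 group `θ.res.X · |>.S13 ∕ c13` (Stage 4(X.B13) — e.g. the torus datum of
`B13NodeKnitRecord5C.b13_main_forall_isRecordOfRecord₅C_twoTorus` ∕ `B13NodeTorusKernel216`), and a K2 item typed over a record predicate that leaves that
group residual is refutable by this witness.

HONEST FRAMING: count-neutral; N10 NOT discharged and NOT refuted — nothing here is about [Balaban1988RG2Cluster] at Bałaban's objects; one finite
four-torus programme at fixed ε; nothing continuum ∕ ℝ⁴ ∕ OS ∕ mass-gap ∕ Clay.
-/

noncomputable section

namespace Literature.MathematicalPhysics.QuantumFieldTheory.Balaban1983to89.B13ResidualSlotProbe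

open DagBinding T4Continuum Node00
open Literature.MathematicalPhysics.QuantumFieldTheory.Balaban1983to89.B13ResidualLeafProbe (exists_stepData_not_lemma1)
open Literature.MathematicalPhysics.QuantumFieldTheory.Balaban1983to89.B11LeafUnpinnedRecord
  (isRecordOfRecord₅C_updXYZ isRecordOfRecord₈C_updXYZ exists_b11Leaf)
open Literature.MathematicalPhysics.QuantumFieldTheory.Balaban1983to89.B9LeafKnitNonVacuity (exists_b9LeafX_of_vanishing_operators)

/-! ## §1 The `∃`-dual witness: a step datum with no localization domains satisfies Lemmas 1–3 as typed -/

/-- **Vacuity of the typed B13 triple on EMPTY localization-domain systems**: some `S : B13.StepData` (no domains in `𝐃_k`, `𝐃_{k+1}`, no bonds) satisfies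
`Lemma1Printed S c ∧ Lemma2Printed S c ∧ Lemma3Printed S c` for EVERY constants record `c` — every `∀ Y ∈ 𝐃_k` ∕ `∀ Z ∈ 𝐃_{k+1}` is vacuous.  (The typed
leaf has content only at Bałaban's domains; companion of `B13ResidualLeafProbe.exists_stepData_not_lemma1`.)
[cite: Balaban1988RG2Cluster, Lemma 1 p.9, Lemma 2 p.11, Lemma 3 p.20 (typed leaf; vacuity probe)] -/
theorem exists_stepData_b13Triple :
    ∃ S : B13.StepData, ∀ c : B13.Consts, B13.Lemma1Printed S c ∧ B13.Lemma2Printed S c ∧ B13.Lemma3Printed S c := by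
  refine ⟨{ Dk := { Dom := PEmpty, dj := (fun x => nomatch x), dj_nonneg := (fun x => nomatch x) },
            Dk1 := { Dom := PEmpty, dj := (fun x => nomatch x), dj_nonneg := (fun x => nomatch x) },
            volk := (fun x => nomatch x), Φ := PUnit, Bond := PEmpty, sp1 := (fun x => nomatch x), sp2 := (fun x => nomatch x),
            Bv := (fun _ b => nomatch b), Vp := (fun x => nomatch x), V := (fun x => nomatch x), Q := (fun x => nomatch x),
            Vpp := (fun x => nomatch x), H := (fun x => nomatch x), Ek1 := (fun x => nomatch x), Elog := (fun x => nomatch x),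
            Analytic := fun _ _ => True, GaugeInv := fun _ => True, Repr17 := True, Restr := True }, fun c => ⟨?_, ?_, ?_⟩⟩
  · exact ⟨(fun Y => nomatch Y), (fun Y => nomatch Y)⟩
  · exact ⟨(fun Y => nomatch Y), (fun Y => nomatch Y), (fun Y => nomatch Y), (fun Y => nomatch Y), (fun Y => nomatch Y)⟩
  · exact (fun _ Z => nomatch Z)

variable {F : T4Family} {N : ℕ} [NeZero N]

/-! ## §2 The displayed slot (B13₅) is FALSE over the Stage-5 parameters -/

/-- **THE IN-EDGES DO NOT RESCUE THE SLOT**: as soon as one admissible Stage-5 parameter `θ₀` exists, the displayed slot (B13₅) «for every admissible `θ`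
and run `P`, `B9LeafX (θ.res.Y P)` → ([Balaban1985UV3] Thm 1 compact ∧ Thm 2 over `(θ.res.X P).runs10`) → `B11Leaf (θ.res.Z P)` → [I] Lemma 4 over
`(θ.res.X P).F12 ∕ c12` → Lemmas 1–3 for `((θ.res.X P).S13, (θ.res.X P).c13)`» — the hypothesis `slots` of `B13NodeKnitRecord5C.b13_main_forall_isRecordOfRecord₅C`
— is FALSE: at `θ₀` with its residual carriers swapped for the witness of this file all four antecedents hold and Lemma 1 fails.
[cite: Balaban1988RG2Cluster, Lemmas 1–3 pp.9, 11, 20; p.1 (in-edges [13], [16], [15], [I]) (typed leaf at NODE 00's Stage-5 parameters; vacuity probe)] -/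
theorem not_slot₅C (θ₀ : Stage5Params F N) (h₀ : θ₀.Admissible) :
    ¬ ∀ θ : Stage5Params F N, θ.Admissible → ∀ P : B12.RunParams,
        B9LeafX (θ.res.Y P) →
          (B10.Thm1PrintedCompact (θ.res.X P).runs10 ∧ B10.Thm2Printed (θ.res.X P).runs10) →
            B11Leaf (θ.res.Z P) → B12Sec2to5.Lemma4Printed (θ.res.X P).F12 (θ.res.X P).c12 →
              B13.Lemma1Printed (θ.res.X P).S13 (θ.res.X P).c13 ∧ B13.Lemma2Printed (θ.res.X P).S13 (θ.res.X P).c13 ∧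
                B13.Lemma3Printed (θ.res.X P).S13 (θ.res.X P).c13 := by
  intro hslot
  obtain ⟨Y₁, -, -, -, hY₁⟩ := exists_b9LeafX_of_vanishing_operators
  obtain ⟨Z₁, -, hZ₁⟩ := exists_b11Leaf
  -- the junk B13 step of `B13ResidualLeafProbe` at the run's constants
  let junk : B12.RunParams → B13.StepData := fun P => Classical.choose (exists_stepData_not_lemma1 ((θ₀.res.X P).c13))
  have hjunk : ∀ P, ¬ B13.Lemma1Printed (junk P) ((θ₀.res.X P).c13) := fun P =>
    Classical.choose_spec (exists_stepData_not_lemma1 ((θ₀.res.X P).c13))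
  let X' : B12.RunParams → PrintedCarriersR := fun P =>
    { θ₀.res.X P with I10 := PEmpty, runs10 := (fun i => nomatch i), c12 := ⟨0, 0, 0, 0, 0, 0, 0, 0, 0, 0⟩, S13 := junk P }
  let θ₁ : Stage5Params F N := { θ₀ with res := { θ₀.res with X := X', Y := fun _ => Y₁, Z := fun _ => Z₁ } }
  have h₁ : θ₁.Admissible := h₀
  have h10 : B10.Thm1PrintedCompact (θ₁.res.X ⟨0, 0, 0⟩).runs10 ∧ B10.Thm2Printed (θ₁.res.X ⟨0, 0, 0⟩).runs10 :=
    ⟨fun _ _ _ _ => ⟨0, (fun i => nomatch i)⟩, (fun i => nomatch i)⟩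
  have h12 : B12Sec2to5.Lemma4Printed (θ₁.res.X ⟨0, 0, 0⟩).F12 (θ₁.res.X ⟨0, 0, 0⟩).c12 := fun hR => absurd hR.1 (lt_irrefl _)
  exact hjunk ⟨0, 0, 0⟩ (hslot θ₁ h₁ ⟨0, 0, 0⟩ hY₁ h10 hZ₁ h12).1

variable (F N) in
/-- **The slot (B13₅) is FALSE, unconditionally** (admissible Stage-5 parameters exist on every family: those of dag-n24-a's ₅C record
`Node00.N24_exists_isRecordOfRecord₅C`).  Hence the hypothesis `slots` of the seat's closers `B13NodeKnitRecord5C.b13_main_forall_isRecordOfRecord₅C`,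
`…N10AtRecord.s_N10_of_refines₅C ∕ _rec₅C ∕ _rec₇C ∕ _rec₈C` is unsatisfiable as it stands: those closers carry content only through a PIN of the
residual B13 group (Stage 4(X.B13)). [cite: Balaban1988RG2Cluster, Lemmas 1–3 pp.9, 11, 20 (typed leaf at NODE 00's Stage-5 parameters; vacuity probe)] -/
theorem not_slot₅C' :
    ¬ ∀ θ : Stage5Params F N, θ.Admissible → ∀ P : B12.RunParams,
        B9LeafX (θ.res.Y P) →
          (B10.Thm1PrintedCompact (θ.res.X P).runs10 ∧ B10.Thm2Printed (θ.res.X P).runs10) →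
            B11Leaf (θ.res.Z P) → B12Sec2to5.Lemma4Printed (θ.res.X P).F12 (θ.res.X P).c12 →
              B13.Lemma1Printed (θ.res.X P).S13 (θ.res.X P).c13 ∧ B13.Lemma2Printed (θ.res.X P).S13 (θ.res.X P).c13 ∧
                B13.Lemma3Printed (θ.res.X P).S13 (θ.res.X P).c13 := by
  obtain ⟨D, w, θ₀, h₀, -⟩ := N24_exists_isRecordOfRecord₅C F N
  exact not_slot₅C θ₀ h₀

/-! ## §3 At the record predicate of record ₅C: the in-edges hold and `b13` fails; N10 is undetermined -/

section Record5C

variable {D : FiniteEpsData F (SU N)} {w : WorldP}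

/-- **Given ONE ₅C record, there is a ₅C record over the SAME datum at every run of which the in-edge leaves `b9`, `b10`, `b11`, `b12` HOLD and N10's own
leaf `b13` FAILS** (the witness of the file header: [B9] bundle with vanishing operators, empty [B11] index, empty [B10] run family, zero [I]-Lemma-4
constants, g5's junk B13 step). [cite: Balaban1988RG2Cluster, Lemmas 1–3 pp.9, 11, 20; p.1 (in-edges) (typed leaves at NODE 00's Stage-5 record; vacuity probe)] -/
theorem exists_record₅C_inEdges_not_b13 (h : IsRecordOfRecord₅C F N D w) :
    ∃ w' : WorldP, IsRecordOfRecord₅C F N D w' ∧ ∀ P : B12.RunParams,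
      (leavesP w' P).b9 ∧ (leavesP w' P).b10 ∧ (leavesP w' P).b11 ∧ (leavesP w' P).b12 ∧ ¬ (leavesP w' P).b13 := by
  obtain ⟨θ, -, -, hrec⟩ := isRecordOfRecord₅C_updXYZ h
  obtain ⟨Y₁, -, -, -, hY₁⟩ := exists_b9LeafX_of_vanishing_operators
  obtain ⟨Z₁, -, hZ₁⟩ := exists_b11Leaf
  let junk : B12.RunParams → B13.StepData := fun P => Classical.choose (exists_stepData_not_lemma1 ((θ.res.X P).c13))
  have hjunk : ∀ P, ¬ B13.Lemma1Printed (junk P) ((θ.res.X P).c13) := fun P =>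
    Classical.choose_spec (exists_stepData_not_lemma1 ((θ.res.X P).c13))
  let X' : B12.RunParams → PrintedCarriersR := fun P =>
    { θ.res.X P with I10 := PEmpty, runs10 := (fun i => nomatch i), c12 := ⟨0, 0, 0, 0, 0, 0, 0, 0, 0, 0⟩, S13 := junk P }
  let θ' : Stage5Params F N := { θ with res := { θ.res with X := X', Y := fun _ => Y₁, Z := fun _ => Z₁ } }
  refine ⟨_, hrec X' (fun _ => Y₁) (fun _ => Z₁), fun P => ?_⟩
  have key := B13NodeKnitRecord5C.inEdges_iff_res₅C F N θ' { w with up := fun P => upOfRecord₅C F N θ' P } P rfl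
  have h13 := B13NodeKnitRecord5C.b13_leaf_iff_res₅C F N θ' { w with up := fun P => upOfRecord₅C F N θ' P } P rfl
  refine ⟨key.1.2 hY₁, key.2.1.2 ⟨fun _ _ _ _ => ⟨0, (fun i => nomatch i)⟩, (fun i => nomatch i)⟩, key.2.2.1.2 hZ₁,
    key.2.2.2.2 fun hR => absurd hR.1 (lt_irrefl _), fun hb => hjunk P (h13.1 hb).1⟩

/-- **Hence: given ONE ₅C record, a ₅C record over the same datum at every run of which the in-edge NODES N06 (`Dag.B9_main`), N08 (`Dag.B10_main`), N07
(`Dag.B11_main`), N09 (`Dag.B12_main`) HOLD and N10 (`Dag.B13_main`) FAILS** — N09's consequent reads `b12 ∧ (b12 → b13 → …)`, true since `b13` is false.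
So no conjunction of sister stubs rescues `S_N10` over ₅C. [cite: Balaban1988RG2Cluster, p.1 and Lemma 3 p.20 (the node «[13], [16], [15], [I] ⇒ Lemmas 1–3» at NODE 00's Stage-5 record; vacuity probe)] -/
theorem exists_record₅C_sisters_not_b13_main (h : IsRecordOfRecord₅C F N D w) :
    ∃ w' : WorldP, IsRecordOfRecord₅C F N D w' ∧ ∀ P : B12.RunParams,
      Dag.B9_main (leavesP w' P) ∧ Dag.B10_main (leavesP w' P) ∧ Dag.B11_main (leavesP w' P) ∧ Dag.B12_main (leavesP w' P) ∧
        ¬ Dag.B13_main (leavesP w' P) := by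
  obtain ⟨w', hw', hl⟩ := exists_record₅C_inEdges_not_b13 h
  refine ⟨w', hw', fun P => ?_⟩
  obtain ⟨h9, h10, h11, h12, hn13⟩ := hl P
  exact ⟨fun _ _ _ _ => h9, fun _ _ _ _ _ _ => h10, fun _ _ _ _ _ => h11,
    fun _ _ _ _ _ _ _ _ => ⟨h12, fun _ hb _ => absurd hb hn13⟩, fun hN => hn13 (hN h9 h10 h11 h12)⟩

/-- **The `∃`-dual is junk-provable: given ONE ₅C record, a ₅C record over the same datum at every run of which `b13` — hence N10 — HOLDS** (vacuously: the
residual B13 step replaced by the empty-domain datum of `exists_stepData_b13Triple`; `Y`, `Z` unchanged). [cite: Balaban1988RG2Cluster, Lemmas 1–3 pp.9, 11, 20 (typed leaf at NODE 00's Stage-5 record; the `∃`-dual is vacuous)] -/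
theorem exists_record₅C_b13_main (h : IsRecordOfRecord₅C F N D w) :
    ∃ w' : WorldP, IsRecordOfRecord₅C F N D w' ∧ ∀ P : B12.RunParams, (leavesP w' P).b13 ∧ Dag.B13_main (leavesP w' P) := by
  obtain ⟨θ, -, -, hrec⟩ := isRecordOfRecord₅C_updXYZ h
  obtain ⟨S₁, hS₁⟩ := exists_stepData_b13Triple
  let X' : B12.RunParams → PrintedCarriersR := fun P => { θ.res.X P with S13 := S₁ }
  let θ' : Stage5Params F N := { θ with res := { θ.res with X := X', Y := θ.res.Y, Z := θ.res.Z } }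
  refine ⟨_, hrec X' θ.res.Y θ.res.Z, fun P => ?_⟩
  have h13 : (leavesP { w with up := fun P => upOfRecord₅C F N θ' P } P).b13 :=
    (B13NodeKnitRecord5C.b13_leaf_iff_res₅C F N θ' { w with up := fun P => upOfRecord₅C F N θ' P } P rfl).2 (hS₁ _)
  exact ⟨h13, fun _ _ _ _ => h13⟩

/-- **«N10 at every run of every ₅C record world» is FALSE** (given one ₅C record on the family). [cite: Balaban1988RG2Cluster, Lemmas 1–3 pp.9, 11, 20 (the universal form of the node over NODE 00's unpinned Stage-5 record is refutable; vacuity probe)] -/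
theorem not_forall_record₅C_b13_main (h : IsRecordOfRecord₅C F N D w) :
    ¬ ∀ (D' : FiniteEpsData F (SU N)) (w' : WorldP), IsRecordOfRecord₅C F N D' w' → ∀ P : B12.RunParams, Dag.B13_main (leavesP w' P) := by
  intro hall
  obtain ⟨w', hw', hl⟩ := exists_record₅C_sisters_not_b13_main h
  exact (hl ⟨0, 0, 0⟩).2.2.2.2 (hall D w' hw' _)

end Record5C

variable (F N) in
/-- **N10 is UNDETERMINED over NODE 00's Stage-5 record predicate of record** (absolute form; ₅C records exist on every family by dag-n24-a's
`Node00.N24_exists_isRecordOfRecord₅C`): `Dag.B13_main` HOLDS at every run of one ₅C record and FAILS — with all four in-edge nodes holding — at every run of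
another.  Neither «`∀ D w, IsRecordOfRecord₅C F N D w → ∀ P, Dag.B13_main (leavesP w P)`» (= `YMDAG.UVSplit.S_N10` at ₅C) nor its `∃`-dual carries content;
the residual B13 group must be PINNED (Stage 4(X.B13)) before N10 is typed over a record predicate. [cite: Balaban1988RG2Cluster, Lemmas 1–3 pp.9, 11, 20; p.1 (independence of the typed node over NODE 00's Stage-5 record predicate; vacuity probe)] -/
theorem b13_main_undetermined_over_record₅C :
    (∃ (D : FiniteEpsData F (SU N)) (w : WorldP), IsRecordOfRecord₅C F N D w ∧ ∀ P : B12.RunParams, Dag.B13_main (leavesP w P)) ∧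
    (∃ (D : FiniteEpsData F (SU N)) (w : WorldP), IsRecordOfRecord₅C F N D w ∧ ∀ P : B12.RunParams,
      Dag.B9_main (leavesP w P) ∧ Dag.B10_main (leavesP w P) ∧ Dag.B11_main (leavesP w P) ∧ Dag.B12_main (leavesP w P) ∧
        ¬ Dag.B13_main (leavesP w P)) := by
  obtain ⟨D, w, h⟩ := N24_exists_isRecordOfRecord₅C F N
  obtain ⟨w₁, hw₁, h₁⟩ := exists_record₅C_b13_main h
  obtain ⟨w₀, hw₀, h₀⟩ := exists_record₅C_sisters_not_b13_main h
  exact ⟨⟨D, w₁, hw₁, fun P => (h₁ P).2⟩, ⟨D, w₀, hw₀, h₀⟩⟩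

variable (F N) in
/-- **NO N10 CLOSER OVER ₅C, unconditionally**: `¬ ∀ D w, IsRecordOfRecord₅C F N D w → ∀ P, Dag.B13_main (leavesP w P)` — the displayed (in-edge-guarded)
form of g5's `B13ResidualLeafProbe.not_forall_record₅C_b13`. [cite: Balaban1988RG2Cluster, Lemmas 1–3 pp.9, 11, 20 (vacuity probe over NODE 00's Stage-5 record predicate)] -/
theorem not_forall_record₅C_b13_main' :
    ¬ ∀ (D : FiniteEpsData F (SU N)) (w : WorldP), IsRecordOfRecord₅C F N D w → ∀ P : B12.RunParams, Dag.B13_main (leavesP w P) := by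
  obtain ⟨D, w, h⟩ := N24_exists_isRecordOfRecord₅C F N
  exact not_forall_record₅C_b13_main h

/-! ## §4 The same at the Stage-8 record predicate ₈C (and ₇C by refinement) -/

section Record8C

variable {D : FiniteEpsData F (SU N)} {w : WorldP}

/-- **Given ONE ₈C record, there is an ₈C record over the SAME datum at every run of which `b9`, `b10`, `b11`, `b12` HOLD and `b13` FAILS** (the Stage-7 ∕
Stage-8 overwrites `βfun, χ, dom, E, R`, actions and format predicates do not touch the carrier families `X, Y, Z`: `B11LeafUnpinnedRecord.isRecordOfRecord₈C_updXYZ`).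
[cite: Balaban1988RG2Cluster, Lemmas 1–3 pp.9, 11, 20; p.1 (in-edges) (typed leaves at NODE 00's Stage-8 record; vacuity probe)] -/
theorem exists_record₈C_inEdges_not_b13 (h : IsRecordOfRecord₈C F N D w) :
    ∃ w' : WorldP, IsRecordOfRecord₈C F N D w' ∧ ∀ P : B12.RunParams,
      (leavesP w' P).b9 ∧ (leavesP w' P).b10 ∧ (leavesP w' P).b11 ∧ (leavesP w' P).b12 ∧ ¬ (leavesP w' P).b13 := by
  obtain ⟨θ, -, -, hrec⟩ := isRecordOfRecord₈C_updXYZ h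
  obtain ⟨Y₁, -, -, -, hY₁⟩ := exists_b9LeafX_of_vanishing_operators
  obtain ⟨Z₁, -, hZ₁⟩ := exists_b11Leaf
  let junk : B12.RunParams → B13.StepData := fun P => Classical.choose (exists_stepData_not_lemma1 ((θ.res.X P).c13))
  have hjunk : ∀ P, ¬ B13.Lemma1Printed (junk P) ((θ.res.X P).c13) := fun P =>
    Classical.choose_spec (exists_stepData_not_lemma1 ((θ.res.X P).c13))
  let X' : B12.RunParams → PrintedCarriersR := fun P =>
    { θ.res.X P with I10 := PEmpty, runs10 := (fun i => nomatch i), c12 := ⟨0, 0, 0, 0, 0, 0, 0, 0, 0, 0⟩, S13 := junk P }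
  let θ' : Stage5Params F N := Stage8Params.toStage5 F N { θ with res := { θ.res with X := X', Y := fun _ => Y₁, Z := fun _ => Z₁ } }
  refine ⟨_, hrec X' (fun _ => Y₁) (fun _ => Z₁), fun P => ?_⟩
  have key := B13NodeKnitRecord5C.inEdges_iff_res₅C F N θ' { w with up := fun P => upOfRecord₅C F N θ' P } P rfl
  have h13 := B13NodeKnitRecord5C.b13_leaf_iff_res₅C F N θ' { w with up := fun P => upOfRecord₅C F N θ' P } P rfl
  refine ⟨key.1.2 hY₁, key.2.1.2 ⟨fun _ _ _ _ => ⟨0, (fun i => nomatch i)⟩, (fun i => nomatch i)⟩, key.2.2.1.2 hZ₁,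
    key.2.2.2.2 fun hR => absurd hR.1 (lt_irrefl _), fun hb => hjunk P (h13.1 hb).1⟩

/-- **Given ONE ₈C record, an ₈C record over the same datum at every run of which N06, N08, N07, N09 HOLD and N10 FAILS.**
[cite: Balaban1988RG2Cluster, p.1 and Lemma 3 p.20 (the node at NODE 00's Stage-8 record; vacuity probe)] -/
theorem exists_record₈C_sisters_not_b13_main (h : IsRecordOfRecord₈C F N D w) :
    ∃ w' : WorldP, IsRecordOfRecord₈C F N D w' ∧ ∀ P : B12.RunParams,
      Dag.B9_main (leavesP w' P) ∧ Dag.B10_main (leavesP w' P) ∧ Dag.B11_main (leavesP w' P) ∧ Dag.B12_main (leavesP w' P) ∧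
        ¬ Dag.B13_main (leavesP w' P) := by
  obtain ⟨w', hw', hl⟩ := exists_record₈C_inEdges_not_b13 h
  refine ⟨w', hw', fun P => ?_⟩
  obtain ⟨h9, h10, h11, h12, hn13⟩ := hl P
  exact ⟨fun _ _ _ _ => h9, fun _ _ _ _ _ _ => h10, fun _ _ _ _ _ => h11,
    fun _ _ _ _ _ _ _ _ => ⟨h12, fun _ hb _ => absurd hb hn13⟩, fun hN => hn13 (hN h9 h10 h11 h12)⟩

/-- **The `∃`-dual at ₈C: given ONE ₈C record, an ₈C record over the same datum at every run of which `b13` — hence N10 — HOLDS** (vacuously).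
[cite: Balaban1988RG2Cluster, Lemmas 1–3 pp.9, 11, 20 (typed leaf at NODE 00's Stage-8 record; the `∃`-dual is vacuous)] -/
theorem exists_record₈C_b13_main (h : IsRecordOfRecord₈C F N D w) :
    ∃ w' : WorldP, IsRecordOfRecord₈C F N D w' ∧ ∀ P : B12.RunParams, (leavesP w' P).b13 ∧ Dag.B13_main (leavesP w' P) := by
  obtain ⟨θ, -, -, hrec⟩ := isRecordOfRecord₈C_updXYZ h
  obtain ⟨S₁, hS₁⟩ := exists_stepData_b13Triple
  let X' : B12.RunParams → PrintedCarriersR := fun P => { θ.res.X P with S13 := S₁ }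
  let θ' : Stage5Params F N := Stage8Params.toStage5 F N { θ with res := { θ.res with X := X', Y := θ.res.Y, Z := θ.res.Z } }
  refine ⟨_, hrec X' θ.res.Y θ.res.Z, fun P => ?_⟩
  have h13 : (leavesP { w with up := fun P => upOfRecord₅C F N θ' P } P).b13 :=
    (B13NodeKnitRecord5C.b13_leaf_iff_res₅C F N θ' { w with up := fun P => upOfRecord₅C F N θ' P } P rfl).2 (hS₁ _)
  exact ⟨h13, fun _ _ _ _ => h13⟩

/-- **«N10 at every run of every ₈C record world» is FALSE** (given one ₈C record on the family). [cite: Balaban1988RG2Cluster, Lemmas 1–3 pp.9, 11, 20 (the universal form of the node over NODE 00's unpinned Stage-8 record is refutable; vacuity probe)] -/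
theorem not_forall_record₈C_b13_main (h : IsRecordOfRecord₈C F N D w) :
    ¬ ∀ (D' : FiniteEpsData F (SU N)) (w' : WorldP), IsRecordOfRecord₈C F N D' w' → ∀ P : B12.RunParams, Dag.B13_main (leavesP w' P) := by
  intro hall
  obtain ⟨w', hw', hl⟩ := exists_record₈C_sisters_not_b13_main h
  exact (hl ⟨0, 0, 0⟩).2.2.2.2 (hall D w' hw' _)

/-- N10 is UNDETERMINED over `IsRecordOfRecord₈C` (relative to one ₈C record). [cite: Balaban1988RG2Cluster, Lemmas 1–3 pp.9, 11, 20 (independence of the typed node over NODE 00's Stage-8 record predicate; vacuity probe)] -/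
theorem b13_main_undetermined_over_record₈C (h : IsRecordOfRecord₈C F N D w) :
    (∃ w' : WorldP, IsRecordOfRecord₈C F N D w' ∧ ∀ P : B12.RunParams, Dag.B13_main (leavesP w' P)) ∧
    (∃ w' : WorldP, IsRecordOfRecord₈C F N D w' ∧ ∀ P : B12.RunParams, ¬ Dag.B13_main (leavesP w' P)) := by
  obtain ⟨w₁, hw₁, h₁⟩ := exists_record₈C_b13_main h
  obtain ⟨w₀, hw₀, h₀⟩ := exists_record₈C_sisters_not_b13_main h
  exact ⟨⟨w₁, hw₁, fun P => (h₁ P).2⟩, ⟨w₀, hw₀, fun P => (h₀ P).2.2.2.2⟩⟩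

end Record8C

variable (F N) in
/-- **NO N10 CLOSER OVER ₈C, unconditionally** (₈C is inhabited on every family: `Node00.Record8Inhabited.exists_isRecordOfRecord₈C`, the degenerate zero-chart
record — the leaves N10 reads see no chart, so degeneracy is immaterial). [cite: Balaban1988RG2Cluster, Lemmas 1–3 pp.9, 11, 20 (vacuity probe over NODE 00's Stage-8 record predicate)] -/
theorem not_forall_record₈C_b13_main' :
    ¬ ∀ (D : FiniteEpsData F (SU N)) (w : WorldP), IsRecordOfRecord₈C F N D w → ∀ P : B12.RunParams, Dag.B13_main (leavesP w P) := by
  obtain ⟨D, w, h⟩ := Record8Inhabited.exists_isRecordOfRecord₈C F N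
  exact not_forall_record₈C_b13_main h

variable (F N) in
/-- **A ₇C record at which all in-edge nodes hold and N10 fails at every run, unconditionally** (the ₈C witness through the refinement
`Node00.isRecordOfRecord₇C_of_isRecordOfRecord₈C`, which keeps datum and world). [cite: Balaban1988RG2Cluster, Lemmas 1–3 pp.9, 11, 20 (vacuity probe over NODE 00's Stage-7 record predicate)] -/
theorem exists_record₇C_sisters_not_b13_main :
    ∃ (D : FiniteEpsData F (SU N)) (w : WorldP), IsRecordOfRecord₇C F N D w ∧ ∀ P : B12.RunParams,
      Dag.B9_main (leavesP w P) ∧ Dag.B10_main (leavesP w P) ∧ Dag.B11_main (leavesP w P) ∧ Dag.B12_main (leavesP w P) ∧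
        ¬ Dag.B13_main (leavesP w P) := by
  obtain ⟨D, w, h⟩ := Record8Inhabited.exists_isRecordOfRecord₈C F N
  obtain ⟨w', hw', hl⟩ := exists_record₈C_sisters_not_b13_main h
  exact ⟨D, w', isRecordOfRecord₇C_of_isRecordOfRecord₈C hw', hl⟩

variable (F N) in
/-- **NO N10 CLOSER OVER ₇C, unconditionally**. [cite: Balaban1988RG2Cluster, Lemmas 1–3 pp.9, 11, 20 (vacuity probe over NODE 00's Stage-7 record predicate)] -/
theorem not_forall_record₇C_b13_main' :
    ¬ ∀ (D : FiniteEpsData F (SU N)) (w : WorldP), IsRecordOfRecord₇C F N D w → ∀ P : B12.RunParams, Dag.B13_main (leavesP w P) := by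
  intro hall
  obtain ⟨D, w, h, hl⟩ := exists_record₇C_sisters_not_b13_main F N
  exact (hl ⟨0, 0, 0⟩).2.2.2.2 (hall D w h _)

end Literature.MathematicalPhysics.QuantumFieldTheory.Balaban1983to89.B13ResidualSlotProbe

end
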